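import Mathlib.NumberTheory.ArithmeticFunction.Moebius
import Mathlib.NumberTheory.ArithmeticFunction.Liouville
import Mathlib.Analysis.SpecialFunctions.Pow.Real
import Mathlib.Analysis.SpecialFunctions.Log.Basic
import Mathlib.Order.Filter.AtTopBot.Basic
import Literature.Computability.Complexity.ConstantDepth
import Literature.Probability.RandomGraphs.LowDegree
import HarnessLib

/-!
# Möbius and Liouville versus bounded-depth circuits and the Walsh system (Green 2012, Bourgain 2013)

Named facts (D-0014, sorry-free `def … : Prop`) recording the two printed instances of the
"Möbius randomness principle" for functions of the binary digits of the argument: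

* `green_moebius_AC0` — B. Green, *On (not) computing the Möbius function using bounded depth
  circuits*, Combin. Probab. Comput. 21 (2012), Theorem 1, AS PRINTED: for `N = 2^n` and
  `F : {0, …, N − 1} → {−1, 1}` computed from the `n` binary digits by a circuit of depth `≤ d`
  and size `≤ n^d` (∧/∨ gates of arbitrary fan-in and ¬ gates; depth = longest input–output
  path, every gate counting one; size = number of gates), `|𝔼_{x < N} μ(x) F(x)| ≤ K e^{d log n − c n^{1/(6d)}}`
  with absolute constants `c > 0`, `K`.
* `green_liouville_AC0` — the same paper, p. 3: "All of the results in this paper hold equally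
  well for the Liouville function, with very similar proofs", recorded in the QUALITATIVE form of
  the abstract / the Remark after Theorem 1 ("the bound is `o(1)` … in particular for any fixed
  `d`") and in the conventions of the tree's class `Literature.Computability.Complexity.AC0`
  (depth `Circuit.acDepth` with negations free, size bounded by a polynomial): for fixed depth,
  a fixed polynomial size bound and `ε > 0`, eventually in `n` every such circuit `C` has
  `|∑_{x < 2^n} λ(x) sgn(C(bits x))| ≤ ε 2^n`. (Reduction to the printed form: push the free
  negations to the inputs by De Morgan — depth `≤ d + 1` with every gate counted, size
  `≤ 2·size + n ≤ n^{d'}` for `n` large — and apply Theorem 1 with `d' = max (d + 1, deg p + 2)`.)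
  This is the statement that yields `L_λ ∉ AC⁰` for the Liouville language.
* `bourgain_moebius_walsh` — J. Bourgain, *Möbius–Walsh correlation bounds and an estimate of
  Mauduit and Rivat*, J. Anal. Math. 119 (2013), Theorem 1, AS PRINTED: for `λ` large enough,
  `max_{A ⊆ {0,…,λ−1}} |∑_{n < 2^λ} μ(n) w_A(n)| < 2^{λ − λ^{1/10}}`, where
  `w_A(x) = ∏_{j ∈ A} (1 − 2 x_j)` is the Walsh function of the binary digits `x = ∑_{j<λ} x_j 2^j`
  (tree: `Literature.Probability.RandomGraphs.LowDegree.walsh A (fun j => x.testBit j)`).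
* `bourgain_liouville_walsh` — the parenthesis of the same Theorem 1, "(a similar estimate is also
  valid for the Liouville function)", recorded with the saving exponent left unspecified
  (`∃ c > 0`, bound `2^{λ − λ^c}`), since the paper does not print the Liouville exponent.

All four are THEOREMS in print (not conjectures); none is proved in the tree. They ground the
support items `LiouvilleNotAC0` of route `Summit.PneNP.PneNP.Theses.Mobius` (Green's theorem =
"rung 1") and the degree-one case of its crux `LiouvilleDigitalPhases`, and the items
`WalshLiouvilleBound`, `LiouvilleOrthogonalAC0` of route
`Summit.QuantumAdvantage.QuantumAdvantage.Theses.MobiusLadder`.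

## Conventions
* Digits: `x < 2^n` is read through `fun i : Fin n => Nat.testBit x i` (bit `i` = coefficient of
  `2^i`; Green indexes `x = x₁ + 2x₂ + ⋯`, Bourgain `x = ∑_{0≤j<λ} x_j 2^j` — the same digits).
* `μ(0) = 0` (Green, p. 3: "for the purposes of this paper set `μ(0) = 0`"; Mathlib
  `ArithmeticFunction.map_zero`), likewise `λ(0) = 0` in Mathlib; Bourgain sums over
  `1 ≤ n < 2^λ`, which is the same sum.
* A circuit's Boolean output is turned into `±1` by `sgn` (`true ↦ −1`); the choice of sign is
  immaterial under `|·|`.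
* Green's circuit model (¬ gates anywhere, counted in depth and size) is the tree's
  `Circuit (Fin n)` over `acBasis = {¬} ∪ {∧ₖ, ∨ₖ}` with `Circuit.depth` (every gate weight 1) and
  `Circuit.size` (number of gates): used verbatim in `green_moebius_AC0`.

## Mathlib / tree
Mathlib has `ArithmeticFunction.moebius`, `ArithmeticFunction.liouville`, `Nat.testBit`; no Walsh
system and no circuits (tree: `LowDegree.walsh`, `LowDegree.sgn`, `Complexity.Circuit`,
`Complexity.acBasis`, `Circuit.acDepth`). Searched (`lean search`): `Green2012`, `Bourgain2013`,
`MoebiusWalsh`, `walsh.*moebius`, `Katai` — no prior statement of these facts in the tree.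
-/

open Filter Finset
open Literature.Computability.Complexity
open Literature.Probability.RandomGraphs.LowDegree

namespace Literature.NumberTheory.Sieve

/-- **Green 2012, Theorem 1** (as printed). There are absolute constants `c > 0` and `K` such
that for every `d ≥ 1`, every `n ≥ 1` (`N = 2^n`) and every `F : {0,…,N−1} → {−1,1}` computed
from the binary digits of `x` by a Boolean circuit with ∧/∨ gates of arbitrary fan-in and ¬ gates,
of depth at most `d` (longest input–output path, every gate counted: `Circuit.depth`) and size at
most `n^d` (number of gates: `Circuit.size`) — an "AC⁰(d) function" —
`|𝔼_{0 ≤ x ≤ N−1} μ(x) F(x)| ≤ K · exp (d log n − c n^{1/(6d)})`.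
Printed: "`𝔼 μ(x)F(x) = O(e^{d log n − c n^{1/6d}})`, where `c > 0` is an absolute constant";
the implied `O`-constant is absolute (proof, §2: `O(e^{−cn^{1/3}}) + (2 n^d e^{−c n^{1/6d}})^{1/2}`).
Here `F = sgn ∘ C.eval` on the digit vector `i ↦ x.testBit i` and `μ(0) = 0`.
Grounds (with the `λ`-remark, see `green_liouville_AC0`) item `LiouvilleNotAC0` of
`Summit.PneNP.PneNP.Theses.Mobius`. [cite: Green2012, Theorem 1] -/
def green_moebius_AC0 : Prop :=
  ∃ c : ℝ, 0 < c ∧ ∃ K : ℝ, ∀ d : ℕ, 1 ≤ d → ∀ n : ℕ, 1 ≤ n → ∀ C : Circuit (Fin n),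
    C.IsOver acBasis → C.depth ≤ d → C.size ≤ n ^ d →
      |∑ x ∈ range (2 ^ n),
          (ArithmeticFunction.moebius x : ℝ) * sgn (C.eval fun i : Fin n => x.testBit i)| / 2 ^ n
        ≤ K * Real.exp (d * Real.log n - c * (n : ℝ) ^ (1 / (6 * (d : ℝ))))

/-- **Green 2012, Theorem 1 for the Liouville function, qualitative form** (p. 3: "All of the
results in this paper hold equally well for the Liouville function, with very similar proofs";
abstract and Remark after Theorem 1: the correlation is `o(1)` "in particular for any fixed `d`").
In the tree's `AC⁰` conventions (`Circuit.acDepth`: negations free; polynomial size bound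
`p.eval n`): for every depth `d`, size polynomial `p` and `ε > 0`, for all sufficiently large `n`,
every circuit `C` on `n` input bits over `acBasis` with `acDepth C ≤ d` and `size C ≤ p(n)`
satisfies `|∑_{x < 2^n} λ(x) · sgn (C (bits x))| ≤ ε · 2^n`.
Obtained from the printed Theorem 1 (for `λ`) after pushing negations to the inputs (depth
`≤ d + 1` with all gates counted, size `≤ 2 p(n) + n ≤ n^{d'}` eventually, `d' = max (d+1, deg p + 2)`).
This is exactly the "Möbius randomness for AC⁰" predicate from which `L_λ ∉ AC0` follows;
grounds item `LiouvilleNotAC0` of `Summit.PneNP.PneNP.Theses.Mobius` and items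
`LiouvilleOrthogonalAC0`/`LiouvilleNotAC0` of `Summit.QuantumAdvantage.QuantumAdvantage.Theses.MobiusLadder`.
[cite: Green2012, Theorem 1 and p. 3 (Liouville remark)] -/
def green_liouville_AC0 : Prop :=
  ∀ (d : ℕ) (p : Polynomial ℕ) (ε : ℝ), 0 < ε → ∀ᶠ n : ℕ in atTop, ∀ C : Circuit (Fin n),
    C.IsOver acBasis → C.acDepth ≤ d → C.size ≤ p.eval n →
      |∑ x ∈ range (2 ^ n),
          (ArithmeticFunction.liouville x : ℝ) * sgn (C.eval fun i : Fin n => x.testBit i)|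
        ≤ ε * 2 ^ n

/-- **Bourgain 2013 (Möbius–Walsh), Theorem 1** (as printed; J. Anal. Math. 119, (0.3)). For all
sufficiently large `n` (the paper's `λ`) and every `A ⊆ {0, …, n − 1}`,
`|∑_{x < 2^n} μ(x) w_A(x)| < 2^{n − n^{1/10}}`, where `w_A(x) = ∏_{j ∈ A} (1 − 2x_j)` is the
Walsh function of the binary digits `x = ∑_{j<n} x_j 2^j` (tree: `walsh A (fun j => x.testBit j)`,
`sgn true = −1 = 1 − 2·1`). Uniform over the full Walsh system ("answering a question of
G. Kalai"); the case `|A| = o(√n)` is Green 2012, Prop. 1. The degree-one (Walsh-character) case of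
item `LiouvilleDigitalPhases` of `Summit.PneNP.PneNP.Theses.Mobius` (for `μ`).
[cite: Bourgain2013MoebiusWalsh, Theorem 1] -/
def bourgain_moebius_walsh : Prop :=
  ∀ᶠ n : ℕ in atTop, ∀ A : Finset (Fin n),
    |∑ x ∈ range (2 ^ n),
        (ArithmeticFunction.moebius x : ℝ) * walsh A (fun j : Fin n => x.testBit j)|
      < (2 : ℝ) ^ ((n : ℝ) - (n : ℝ) ^ ((1 : ℝ) / 10))

/-- **Bourgain 2013 (Möbius–Walsh), Theorem 1, Liouville form** — the parenthesis of Theorem 1: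
"(a similar estimate is also valid for the Liouville function)". Recorded with the saving
exponent unspecified, since the paper prints `1/10` only for `μ`: there is `c > 0` such that for
all sufficiently large `n` and every `A ⊆ {0, …, n − 1}`,
`|∑_{x < 2^n} λ(x) w_A(x)| ≤ 2^{n − n^c}`. Grounds the degree-one case of item
`LiouvilleDigitalPhases` of `Summit.PneNP.PneNP.Theses.Mobius` and is (up to the cast
`((λ x : ℤ) : ℝ)`) item `WalshLiouvilleBound` of
`Summit.QuantumAdvantage.QuantumAdvantage.Theses.MobiusLadder`.
[cite: Bourgain2013MoebiusWalsh, Theorem 1 (Liouville remark)] -/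
def bourgain_liouville_walsh : Prop :=
  ∃ c : ℝ, 0 < c ∧ ∀ᶠ n : ℕ in atTop, ∀ A : Finset (Fin n),
    |∑ x ∈ range (2 ^ n),
        (ArithmeticFunction.liouville x : ℝ) * walsh A (fun j : Fin n => x.testBit j)|
      ≤ (2 : ℝ) ^ ((n : ℝ) - (n : ℝ) ^ c)

end Literature.NumberTheory.Sieve
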